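import Summits.CriticalPhenomena.CardyFormulaZ2.Theorems.CardyComplexConeParafermionToSLESixFamiliesDiamondTurnCountMesh
import Summits.CriticalPhenomena.CardyFormulaZ2.Theorems.CardyComplexConeParafermionToSLESixFamiliesDiamondTraceSideLayers
import Summits.CriticalPhenomena.CardyFormulaZ2.Theorems.CardyBoundaryCoulombGasBoundaryDefectGaussianRStubClusterLocalityV2Part1
import Summits.CriticalPhenomena.CardyFormulaZ2.Theorems.CardySusyWardParafermionPrecompactInnerCycleSteps
import HarnessLib

/-!
# The discrete boundary of a diamond discretisation is the two-layer frame of a lattice box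
# (line `potential-darboux-picard-diamond`, S1c `stub_diamondArcsConnected`, part 2)

Crux `ParafermionToSLESixFamilies` (stmt-CriticalPhenomena-11389), line `potential-darboux-picard-diamond`, stub
`stub_diamondArcsConnected` (S1c). In the lattice coordinates `s = x₀ + x₁`, `d = x₁ − x₀` the lattice points of an
open diamond `{|re((z − c)e^{-iπ/4})| < α, |im(·)| < β}` at mesh `δ` form a BOX `a ≤ s ≤ b, a' ≤ d ≤ b'`
(`diamondArcs_exists_box`, registered; `b − a, b' − a' ≥ 6` once `δ < min(α, β)/4`). For data `E` on a convex domain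
read at a mesh where every lattice point of the domain lies in `Ω_δ` and whose lattice points are such a box,
`diamondArcs_zdBoundary_iff_frame` (registered): the discrete boundary `E.zdBoundary` is EXACTLY the two-layer frame
`s ≤ a + 1 ∨ s ≥ b − 1 ∨ d ≤ a' + 1 ∨ d ≥ b' − 1` of the box — a boundary site has an outside lattice point in its `3 × 3`
block; a frame site has an outside neighbour, or an inner and a non-inner face around it, hence a targeted
face-boundary edge. Elementary lattice bookkeeping; nothing cited.
-/

noncomputable section

namespace Summit.CriticalPhenomena.CardyFormulaZ2.Cruxes.ParafermionToSLESixFamilies.PotentialDarbouxPicardDiamond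

open Set Metric Complex
open Literature.Probability Literature.Probability.LatticeModels Literature.Probability.Percolation
open Literature.Probability.LatticeModels.DiscreteDobrushin
open Literature.Probability.RandomPlanarGeometry
open Summit.CriticalPhenomena.CardyFormulaZ2.Cruxes.BoundaryDefectGaussianR.RainbowMonomialsInExcursionKernels
  (neighbour_coords)
open Summit.CriticalPhenomena.CardyFormulaZ2.Cruxes.ParafermionPrecompact.KenyonStreamSecondRelation (faceAt_apply)

namespace ArcsConn

/-! ## The faces around a site, in coordinates -/

/-- A corner of a face, in coordinates. -/
theorem isCorner_coord {v f : Site 2} (h : IsCorner v f) :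
    (v 0 = f 0 ∨ v 0 = f 0 + 1) ∧ (v 1 = f 1 ∨ v 1 = f 1 + 1) := ⟨h 0, h 1⟩

/-- The four corners of a face `f`: `f`, `f + e₀`, `f + e₁`, `f + e₀ + e₁`, with their coordinates. -/
theorem corners_of_face (f : Site 2) :
    IsCorner f f ∧ IsCorner (f + Pi.single 0 1) f ∧ IsCorner (f + Pi.single 1 1) f ∧
      IsCorner (f + Pi.single 0 1 + Pi.single 1 1) f ∧
      ((f + Pi.single 0 1 : Site 2) 0 = f 0 + 1 ∧ (f + Pi.single 0 1 : Site 2) 1 = f 1) ∧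
      ((f + Pi.single 1 1 : Site 2) 0 = f 0 ∧ (f + Pi.single 1 1 : Site 2) 1 = f 1 + 1) ∧
      ((f + Pi.single 0 1 + Pi.single 1 1 : Site 2) 0 = f 0 + 1 ∧
        (f + Pi.single 0 1 + Pi.single 1 1 : Site 2) 1 = f 1 + 1) := by
  refine ⟨isCorner_self f, fun i => ?_, fun i => ?_, fun i => ?_, by simp, by simp, by simp⟩ <;>
    fin_cases i <;> simp

/-- A cyclic intermediate-value step on `Fin 4`: a property holding somewhere and failing somewhere fails at some `m`
while holding at `m + 3`. -/
theorem exists_add_three_and_not {P : Fin 4 → Prop} (h1 : ∃ k, P k) (h2 : ∃ k, ¬ P k) : ∃ m, P (m + 3) ∧ ¬ P m := by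
  obtain ⟨k, hk⟩ := h1
  obtain ⟨k', hk'⟩ := h2
  have e33 : ∀ j : Fin 4, j + 3 + 3 = j + 2 := by decide
  have e23 : ∀ j : Fin 4, j + 2 + 3 = j + 1 := by decide
  have cover : ∀ j j' : Fin 4, j = j' ∨ j = j' + 1 ∨ j = j' + 2 ∨ j = j' + 3 := by decide
  by_cases h3 : P (k' + 3)
  · exact ⟨k', h3, hk'⟩
  by_cases h2' : P (k' + 2)
  · exact ⟨k' + 3, by rwa [e33], h3⟩
  by_cases h1' : P (k' + 1)
  · exact ⟨k' + 2, by rwa [e23], h2'⟩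
  rcases cover k k' with rfl | rfl | rfl | rfl
  · exact absurd hk hk'
  · exact absurd hk h1'
  · exact absurd hk h2'
  · exact absurd hk h3

/-! ## The lattice points of a diamond form a box -/

/-- One tilted coordinate: the integers `s` with `|h s + X₀| < α` form an interval `[a, b]` with
`h (b − a) + 2h ≥ 2α`. -/
theorem exists_int_interval {h X₀ α : ℝ} (hh : 0 < h) :
    ∃ a b : ℤ, (∀ s : ℤ, |h * s + X₀| < α ↔ a ≤ s ∧ s ≤ b) ∧ 2 * α ≤ h * (b - a) + 2 * h := by
  obtain ⟨n, hn, hn'⟩ := exists_lastLayer (X₀ := X₀) (a := α) hh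
  obtain ⟨m, hm, hm'⟩ := exists_lastLayer (X₀ := -X₀) (a := α) hh
  refine ⟨-m, n, fun s => ?_, ?_⟩
  · rw [abs_lt]
    constructor
    · rintro ⟨h1, h2⟩
      constructor
      · by_contra hlt
        have : (s : ℝ) ≤ -m - 1 := by exact_mod_cast (show s ≤ -m - 1 by omega)
        have := mul_le_mul_of_nonneg_left this hh.le
        nlinarith
      · by_contra hlt
        have : (n : ℝ) + 1 ≤ s := by exact_mod_cast (show n + 1 ≤ s by omega)
        have := mul_le_mul_of_nonneg_left this hh.le
        nlinarith
    · rintro ⟨h1, h2⟩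
      have h1' : (-m : ℝ) ≤ s := by exact_mod_cast h1
      have h2' : (s : ℝ) ≤ n := by exact_mod_cast h2
      have := mul_le_mul_of_nonneg_left h1' hh.le
      have := mul_le_mul_of_nonneg_left h2' hh.le
      constructor <;> nlinarith
  · push_cast
    nlinarith

/-- A lower bound on the width of the interval from the smallness of `h`. -/
theorem six_le_of_width {h α : ℝ} {a b : ℤ} (hh : 0 < h) (hhα : 4 * h < α) (hw : 2 * α ≤ h * (b - a) + 2 * h) :
    6 ≤ b - a := by
  by_contra hlt
  have : ((b : ℝ) - a) ≤ 6 := by exact_mod_cast (show b - a ≤ 6 by omega)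
  have := mul_le_mul_of_nonneg_left this hh.le
  nlinarith

end ArcsConn

open ArcsConn

/-- **The lattice points of a small-mesh diamond form a box** (registered helper of `stub_diamondArcsConnected`): for
`0 < δ < min(α, β)/4` there are integers `a, b, a', b'` with `b − a ≥ 6`, `b' − a' ≥ 6` such that the mesh point `δx`
lies in the open diamond `{|re((z − c)e^{-iπ/4})| < α, |im((z − c)e^{-iπ/4})| < β}` iff
`a ≤ x₀ + x₁ ≤ b` and `a' ≤ x₁ − x₀ ≤ b'`. -/
theorem diamondArcs_exists_box : ∀ (c : ℂ) (α β δ : ℝ), 0 < δ → δ < α / 4 → δ < β / 4 → ∃ a b a' b' : ℤ, 6 ≤ b - a ∧ 6 ≤ b' - a' ∧ ∀ x : Site 2, (|((meshPoint δ x - c) * exp (-(Real.pi / 4 : ℝ) * I)).re| < α ∧ |((meshPoint δ x - c) * exp (-(Real.pi / 4 : ℝ) * I)).im| < β) ↔ (a ≤ x 0 + x 1 ∧ x 0 + x 1 ≤ b ∧ a' ≤ x 1 - x 0 ∧ x 1 - x 0 ≤ b') := by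
  intro c α β δ hδ hδα hδβ
  have hs2 : Real.sqrt 2 / 2 < 1 := by
    rw [div_lt_one two_pos, Real.sqrt_lt' two_pos]; norm_num
  have hh : 0 < Real.sqrt 2 / 2 * δ := by positivity
  have hhδ : Real.sqrt 2 / 2 * δ < δ := by nlinarith
  obtain ⟨a, b, hab, hw⟩ := exists_int_interval (X₀ := -(Real.sqrt 2 / 2 * (c.re + c.im))) (α := α) hh
  obtain ⟨a', b', hab', hw'⟩ := exists_int_interval (X₀ := -(Real.sqrt 2 / 2 * (c.im - c.re))) (α := β) hh
  refine ⟨a, b, a', b', six_le_of_width hh (by linarith) hw, six_le_of_width hh (by linarith) hw', fun x => ?_⟩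
  obtain ⟨e1, e2⟩ := tilt_meshPoint δ c x
  have k1 := hab (x 0 + x 1)
  have k2 := hab' (x 1 - x 0)
  push_cast at k1 k2
  rw [e1, e2, show Real.sqrt 2 / 2 * δ * ((x 0 : ℝ) + x 1) - Real.sqrt 2 / 2 * (c.re + c.im) =
    Real.sqrt 2 / 2 * δ * ((x 0 : ℝ) + x 1) + -(Real.sqrt 2 / 2 * (c.re + c.im)) by ring,
    show Real.sqrt 2 / 2 * δ * ((x 1 : ℝ) - x 0) - Real.sqrt 2 / 2 * (c.im - c.re) =
    Real.sqrt 2 / 2 * δ * ((x 1 : ℝ) - x 0) + -(Real.sqrt 2 / 2 * (c.im - c.re)) by ring, k1, k2]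
  tauto

namespace ArcsConn

/-! ## The discrete boundary is the two-layer frame -/

section Frame

variable {Ω : Set ℂ} (hconv : Convex ℝ Ω) {δ : ℝ} (hgood : ∀ x : Site 2, meshPoint δ x ∈ Ω → x ∈ meshDomain Ω δ)
  {E : DiscreteDobrushin} (hΩ : E.Ω = Ω) (hEδ : E.δ = δ) {a b a' b' : ℤ}
  (hbox : ∀ x : Site 2, meshPoint δ x ∈ Ω ↔ (a ≤ x 0 + x 1 ∧ x 0 + x 1 ≤ b ∧ a' ≤ x 1 - x 0 ∧ x 1 - x 0 ≤ b'))
  (hba : 6 ≤ b - a)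

include hconv hgood hΩ hEδ hbox in
/-- A discrete-boundary site lies on the frame (it has an outside lattice point in its `3 × 3` block). -/
theorem mem_frame_of_mem_zdBoundary {x : Site 2} (hx : x ∈ E.zdBoundary) :
    (a ≤ x 0 + x 1 ∧ x 0 + x 1 ≤ b ∧ a' ≤ x 1 - x 0 ∧ x 1 - x 0 ≤ b') ∧
      (x 0 + x 1 ≤ a + 1 ∨ b - 1 ≤ x 0 + x 1 ∨ x 1 - x 0 ≤ a' + 1 ∨ b' - 1 ≤ x 1 - x 0) := by
  have hxin : a ≤ x 0 + x 1 ∧ x 0 + x 1 ≤ b ∧ a' ≤ x 1 - x 0 ∧ x 1 - x 0 ≤ b' := by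
    have := mem_of_mem_zdBoundary hx
    rw [hΩ, hEδ] at this
    exact (hbox x).1 this
  obtain ⟨y, hy, hyout⟩ := exists_near_not_mem_of_mem_zdBoundary hconv hgood hΩ hEδ hx
  rw [hbox] at hyout
  have h0 := abs_le.1 (hy 0)
  have h1 := abs_le.1 (hy 1)
  omega

include hconv hgood hΩ hEδ hbox hba in
/-- A frame site is a discrete-boundary site: either a lattice neighbour is outside, or (all four neighbours being
inside) one face around it is inner and another is not, so that a targeted face-boundary edge ends at it. -/
theorem mem_zdBoundary_of_mem_frame {x : Site 2} (hxbox : a ≤ x 0 + x 1 ∧ x 0 + x 1 ≤ b ∧ a' ≤ x 1 - x 0 ∧ x 1 - x 0 ≤ b')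
    (hfr : x 0 + x 1 ≤ a + 1 ∨ b - 1 ≤ x 0 + x 1 ∨ x 1 - x 0 ≤ a' + 1 ∨ b' - 1 ≤ x 1 - x 0) : x ∈ E.zdBoundary := by
  have hxD : x ∈ meshDomain E.Ω E.δ := by rw [hΩ, hEδ]; exact hgood x ((hbox x).2 hxbox)
  have out : ∀ y : Site 2, ¬ (a ≤ y 0 + y 1 ∧ y 0 + y 1 ≤ b ∧ a' ≤ y 1 - y 0 ∧ y 1 - y 0 ≤ b') →
      meshPoint E.δ y ∉ E.Ω := fun y hy h => by
    rw [hΩ, hEδ, hbox] at h; exact hy h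
  obtain ⟨n0p, n0m, n1p, n1m⟩ := neighbour_coords x
  by_cases hnb : a ≤ x 0 + x 1 + 1 ∧ x 0 + x 1 - 1 ≤ b ∧ a' ≤ x 1 - x 0 - 1 ∧ x 1 - x 0 + 1 ≤ b' ∧
    x 0 + x 1 + 1 ≤ b ∧ a ≤ x 0 + x 1 - 1 ∧ x 1 - x 0 - 1 ≤ b' ∧ a' ≤ x 1 - x 0 + 1
  · -- all four neighbours inside: a non-inner face and an inner face around `x`
    obtain ⟨f0, f1, f2, f3⟩ := faceAt_apply x
    have hnon : ∃ k, ¬ E.IsInnerFace (faceAt x k) := by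
      rcases hfr with h | h | h | h
      · exact ⟨2, not_isInnerFace_of_corner_not_mem (isCorner_self _) (out _ (by omega))⟩
      · have := (corners_of_face (faceAt x 0)).2.2.2.2.2.2
        exact ⟨0, not_isInnerFace_of_corner_not_mem (v := faceAt x 0 + Pi.single 0 1 + Pi.single 1 1)
          (corners_of_face _).2.2.2.1 (out _ (by omega))⟩
      · have := (corners_of_face (faceAt x 3)).2.2.2.2.1
        exact ⟨3, not_isInnerFace_of_corner_not_mem (v := faceAt x 3 + Pi.single 0 1)
          (corners_of_face _).2.1 (out _ (by omega))⟩
      · have := (corners_of_face (faceAt x 1)).2.2.2.2.2.1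
        exact ⟨1, not_isInnerFace_of_corner_not_mem (v := faceAt x 1 + Pi.single 1 1)
          (corners_of_face _).2.2.1 (out _ (by omega))⟩
    have hinn : ∃ k, E.IsInnerFace (faceAt x k) := by
      by_cases hs : x 0 + x 1 + 2 ≤ b
      · refine ⟨0, isInnerFace_of_forall_corner_mem hconv hgood hΩ hEδ fun v hv => (hbox v).2 ?_⟩
        obtain ⟨hv0, hv1⟩ := isCorner_coord hv
        omega
      · refine ⟨2, isInnerFace_of_forall_corner_mem hconv hgood hΩ hEδ fun v hv => (hbox v).2 ?_⟩
        obtain ⟨hv0, hv1⟩ := isCorner_coord hv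
        omega
    obtain ⟨m, hm3, hm⟩ := exists_add_three_and_not (P := fun k => E.IsInnerFace (faceAt x k)) hinn hnon
    exact mem_zdBoundary_of_isInEdge (k := m) ⟨hm3, hm⟩
  · -- some neighbour outside
    have hout : ¬ (a ≤ x 0 + x 1 + 1 ∧ x 0 + x 1 + 1 ≤ b ∧ a' ≤ x 1 - x 0 - 1 ∧ x 1 - x 0 - 1 ≤ b') ∨
        ¬ (a ≤ x 0 + x 1 - 1 ∧ x 0 + x 1 - 1 ≤ b ∧ a' ≤ x 1 - x 0 + 1 ∧ x 1 - x 0 + 1 ≤ b') ∨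
        ¬ (a ≤ x 0 + x 1 + 1 ∧ x 0 + x 1 + 1 ≤ b ∧ a' ≤ x 1 - x 0 + 1 ∧ x 1 - x 0 + 1 ≤ b') ∨
        ¬ (a ≤ x 0 + x 1 - 1 ∧ x 0 + x 1 - 1 ≤ b ∧ a' ≤ x 1 - x 0 - 1 ∧ x 1 - x 0 - 1 ≤ b') := by
      omega
    rcases hout with h | h | h | h
    · refine mem_zdBoundary_of_adj_not_mem_carrier hxD ((zdGraph_adj_iff _ _).2 ⟨0, Or.inl rfl⟩)
        (out (x + Pi.single 0 1) ?_)
      rw [n0p.1, n0p.2]; omega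
    · refine mem_zdBoundary_of_adj_not_mem_carrier hxD ((zdGraph_adj_iff _ _).2 ⟨0, Or.inr (by simp)⟩)
        (out (x - Pi.single 0 1) ?_)
      rw [n0m.1, n0m.2]; omega
    · refine mem_zdBoundary_of_adj_not_mem_carrier hxD ((zdGraph_adj_iff _ _).2 ⟨1, Or.inl rfl⟩)
        (out (x + Pi.single 1 1) ?_)
      rw [n1p.1, n1p.2]; omega
    · refine mem_zdBoundary_of_adj_not_mem_carrier hxD ((zdGraph_adj_iff _ _).2 ⟨1, Or.inr (by simp)⟩)
        (out (x - Pi.single 1 1) ?_)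
      rw [n1m.1, n1m.2]; omega

end Frame

end ArcsConn

/-- **The discrete boundary of a box datum is its two-layer frame** (registered helper of `stub_diamondArcsConnected`):
for data `E` on a convex domain `Ω` read at a mesh `δ` where every lattice point of `Ω` belongs to `Ω_δ`, and whose
lattice points are the box `a ≤ x₀ + x₁ ≤ b`, `a' ≤ x₁ − x₀ ≤ b'` (`b − a ≥ 6`), a site is a discrete
boundary site of `E` iff it is a box point with `x₀ + x₁ ≤ a + 1 ∨ x₀ + x₁ ≥ b − 1 ∨ x₁ − x₀ ≤ a' + 1 ∨ x₁ − x₀ ≥ b' − 1`. -/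
theorem diamondArcs_zdBoundary_iff_frame : ∀ (Ω : Set ℂ), Convex ℝ Ω → ∀ (δ : ℝ), (∀ x : Site 2, meshPoint δ x ∈ Ω → x ∈ meshDomain Ω δ) → ∀ (E : DiscreteDobrushin), E.Ω = Ω → E.δ = δ → ∀ (a b a' b' : ℤ), (∀ x : Site 2, meshPoint δ x ∈ Ω ↔ (a ≤ x 0 + x 1 ∧ x 0 + x 1 ≤ b ∧ a' ≤ x 1 - x 0 ∧ x 1 - x 0 ≤ b')) → 6 ≤ b - a → ∀ x : Site 2, x ∈ E.zdBoundary ↔ ((a ≤ x 0 + x 1 ∧ x 0 + x 1 ≤ b ∧ a' ≤ x 1 - x 0 ∧ x 1 - x 0 ≤ b') ∧ (x 0 + x 1 ≤ a + 1 ∨ b - 1 ≤ x 0 + x 1 ∨ x 1 - x 0 ≤ a' + 1 ∨ b' - 1 ≤ x 1 - x 0)) := by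
  intro Ω hconv δ hgood E hΩ hEδ a b a' b' hbox hba x
  exact ⟨ArcsConn.mem_frame_of_mem_zdBoundary hconv hgood hΩ hEδ hbox,
    fun h => ArcsConn.mem_zdBoundary_of_mem_frame hconv hgood hΩ hEδ hbox hba h.1 h.2⟩

end Summit.CriticalPhenomena.CardyFormulaZ2.Cruxes.ParafermionToSLESixFamilies.PotentialDarbouxPicardDiamond

end
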